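import Summits.AtomisticToContinuum.Crystallization.Theorems.PalmUnimodularRigidityLayeredLawsSelectHcpGlobalInverse
import Summits.AtomisticToContinuum.Crystallization.Theorems.PalmUnimodularRigidityLayeredLawsSelectHcpChartInterpolation

/-!
# Crux `LayeredLawsSelectHcp` (stmt-AtomisticToContinuum-9226), line `mtp-prestress-split-ergodic-frame`:
# the bulk co-Lipschitz floor of tube charts (G5: `tube_bulkCoLipschitz`, `tube_bulkRange`)

**Statement.** For every everywhere-`(1/100)`-good hcp-charted configuration `S` and every rooted labelled chart
`X : ℤ³ → S` (`IsRootedChart`), the chart is GLOBALLY co-Lipschitz against the ideal sites with NO additive constant: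
`9/16 · dist (Pᵢ u) (Pᵢ w) ≤ dist (X u) (X w)` for all labels (`Pᵢ = hcpSite 1 √(2/3)`); in particular
`9/16 · ‖Pᵢ u‖ ≤ ‖X u‖` (the shape of lead c3's G5, `LeadC3FarField.md` §12, with `C₅ = 0`).

**Proof.** The threshold (Kuhn–Freudenthal) interpolant of the chart (`stub_chartInterpolation`: `F (Pᵢ u) = X u`, and on
every ball of radius `1/25` the map `F` is within relative Lipschitz defect `3/8` of a similarity of ratio `≥ 9/10`) is fed to
the global inverse function theorem `stub_globalInverse` (maps of `ℝ³` uniformly locally close to similarities are bijective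
and globally `(1 − δ) m`-co-Lipschitz, via the covering criterion on the simply connected `ℝ³`); `(1 − 3/8)(9/10) = 9/16`.
Space-filling `1 %`-tube charts cannot fold or compress in the bulk — no frame chaining beyond the graph ball of radius `2`,
no scale coherence (which is FALSE: breathing charts, strategist s3), no Liouville rigidity is used.

All `[folklore]`.
-/

noncomputable section

namespace Summit.AtomisticToContinuum.Crystallization.Theorems.PalmUnimodularRigidity.LayeredLawsSelectHcp

open MeasureTheory Set
open Literature.MathematicalPhysics.StatisticalMechanics Literature.Geometry.DiscreteGeometry
open Summit.AtomisticToContinuum.Crystallization.Theorems.LayeredLawsSelectHcp.Negative.DiracLaws (GoodShell)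

/-- **Registered sub-goal `tube_bulkCoLipschitz` (G5, lead c4): the pairwise bulk co-Lipschitz floor `9/16` of tube charts.**
For an everywhere-good hcp-charted `S` and a rooted labelled chart `X`, `9/16 · dist (Pᵢ u) (Pᵢ w) ≤ dist (X u) (X w)` for all
labels `u, w`: the threshold interpolant of the chart (`stub_chartInterpolation`) is a map of `ℝ³` locally `3/8`-close to
similarities of ratio `≥ 9/10` on balls of radius `1/25`, hence globally `(1 − 3/8)(9/10)`-co-Lipschitz (`stub_globalInverse`),
and it agrees with `X` at the ideal sites. [folklore] -/
theorem tube_bulkCoLipschitz :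
    ∀ S : Set (EuclideanSpace ℝ (Fin 3)), (∀ x ∈ S, GoodShell S x) → HcpCharted S →
      ∀ X : ℤ × ℤ × ℤ → EuclideanSpace ℝ (Fin 3), IsRootedChart S X → ∀ u w : ℤ × ℤ × ℤ,
        9 / 16 * dist (hcpSite 1 (Real.sqrt (2 / 3)) u) (hcpSite 1 (Real.sqrt (2 / 3)) w) ≤ dist (X u) (X w) := by
  intro S hS hC X hX u w
  obtain ⟨F, hFX, hloc⟩ := stub_chartInterpolation S hS hC X hX
  obtain ⟨-, hco⟩ := stub_globalInverse F (1 / 25) (3 / 8) (9 / 10) (by norm_num) (by norm_num) (by norm_num)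
    (by norm_num) hloc
  have h := hco (hcpSite 1 (Real.sqrt (2 / 3)) u) (hcpSite 1 (Real.sqrt (2 / 3)) w)
  rw [hFX, hFX] at h
  rw [dist_eq_norm, dist_eq_norm]
  have e : (1 - 3 / 8 : ℝ) * (9 / 10) = 9 / 16 := by norm_num
  rw [e] at h
  exact h

/-- **Registered sub-goal `tube_bulkRange` (lead c3's G5 shape with `C₅ = 0`): `9/16 · ‖Pᵢ u‖ ≤ ‖X u‖` for every label of a
rooted chart** — the pairwise floor at `w = 0` (`X 0 = 0`, `Pᵢ 0 = 0`). [folklore] -/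
theorem tube_bulkRange :
    ∀ S : Set (EuclideanSpace ℝ (Fin 3)), (∀ x ∈ S, GoodShell S x) → HcpCharted S →
      ∀ X : ℤ × ℤ × ℤ → EuclideanSpace ℝ (Fin 3), IsRootedChart S X → ∀ u : ℤ × ℤ × ℤ,
        9 / 16 * ‖hcpSite 1 (Real.sqrt (2 / 3)) u‖ ≤ ‖X u‖ := by
  intro S hS hC X hX u
  have h0 : hcpSite 1 (Real.sqrt (2 / 3)) 0 = 0 := hcpSite_zero 1 (Real.sqrt (2 / 3))
  have hX0 : X 0 = 0 := hX.1
  have := tube_bulkCoLipschitz S hS hC X hX u 0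
  rwa [h0, hX0, dist_zero_right, dist_zero_right] at this

end Summit.AtomisticToContinuum.Crystallization.Theorems.PalmUnimodularRigidity.LayeredLawsSelectHcp

end
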